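import Summits.HodgeConjecture.HodgeConjecture.Theorems.HLiu418E2SliceModulus
import Summits.HodgeConjecture.HodgeConjecture.Theorems.HLiu418E2ArchOrthHolCM
import Literature.NumberTheory.Automorphic.UnitaryCurveCohCotangentFormsConjRep
import Mathlib.Topology.ContinuousMap.Bounded.ArzelaAscoli
import Mathlib.Topology.MetricSpace.Equicontinuity
import Mathlib.Topology.Algebra.Module.FiniteDimension
import HarnessLib

/-!
# Crux `HLiu418`, K-lane E₂ — S3₂ `AdmissibleOfHolValuedType₂` CLOSED (equicontinuity + Arzelà–Ascoli + Riesz) and the named facts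
# `UnitaryCurveForms.cohIsotypicLine₂_hol / _antihol` DISCHARGED BY NAME

Cell `hodgecm-mathlib`, FLOOR 0, programme P5 (`F0_AlbCm`); crux item `stmt-HodgeConjecture-24832`; seat F0P5-p02 (g2),
`--supports stmt-HodgeConjecture-24832`.  THEOREMS ONLY — no definition, no instance, no notation, no `sorry`.

* §1 `apply_mul_eq_apply_mul_adelicSingle` — for a right-`K_f`-invariant cone cotangent form `f` and `h ∈ U(J)(𝔸_F)` with finite part in `K_f`:
  `f(x h) = f(x · ι(u_h))`, `u_h` the `w₁`-component of `h` (product structure + right `K_c`-invariance).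
* §2 `equicontinuous_levelForms` — the family `{toQuotFun f : f ∈ holCotForms₂, right-K_f-invariant, |f| ≤ 1}` read on the compact automorphic
  quotient is EQUICONTINUOUS (uniform modulus ★ `E2SliceModulus.eventually_norm_sub_le` + §1 + openness of `K_f` and of the quotient map), hence
  its closure in `C(X) = X →ᵇ ℂ` is COMPACT (Mathlib `BoundedContinuousFunction.arzela_ascoli`) and it is totally bounded.
* §3 `finite_fixedPoints_of_equivariant` — an irreducible `σ` with a non-zero equivariant linear map `ψ` into cone-holomorphic forms has
  finite-dimensional `K_f`-fixed vectors (`w ↦ toQuotFun (ψ w)` is an injective linear map whose unit ball is totally bounded; Riesz, Mathlib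
  `FiniteDimensional.of_totallyBounded_nhds_zero`); §4 **`admissibleOfHolValued₂_holds`** = the cut `AdmissibleOfHolValuedType₂` TOKEN FOR TOKEN.
* §5 **`cohIsotypicLine₂_hol_holds : UnitaryCurveForms.cohIsotypicLine₂_hol`** and **`cohIsotypicLine₂_antihol_holds : UnitaryCurveForms.cohIsotypicLine₂_antihol`**
  — the P5 printed-citation letters E₂-hol / E₂-antihol ([Liu2021, App. D §D.1, Lem. D.2 (2)]; [BorelWallach2000, VI 4.11, VII 3.2]) are KERNEL
  THEOREMS: ★ `E2ArchOrthHolCM.cohIsotypicLine₂_hol_of_admissible` (S1 ★ `stubS1_holds`, S2⁺₂ ★ `archOrthHol₂_holds`, S2β₂ ★ `density₂_holds`) fed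
  with §4, and ★ `UnitaryCurveForms.cohIsotypicLine₂_antihol_of_hol`.
HONEST LABEL: HC_CM is proved only modulo the printed citations until rung 0 closes; this file discharges the floor-0 named facts E₂-hol / E₂-antihol
(hypothesis `hEh` of ★ `F0AlbCmS1BettiHolds.stub_S1_betti_holds`) and nothing else.

## References
* [Liu2021] Y. Liu, Camb. J. Math. 9 (2021), App. D §D.1 (after Lem. D.1), Lem. D.2 (2), §D.3.
* [BorelWallach2000] A. Borel, N. Wallach, 2nd ed. (2000), VI 4.11, VII 2.10, 3.2.  [BorelJacquet1979] Corvallis PSPM 33.1, §4.2, §4.6.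
* [Borel1997] A. Borel, *Automorphic forms on SL₂(ℝ)* (1997), §8 (finite dimensionality of automorphic forms of given type: compactness).
* [BernsteinZelevinsky1976] §2.1 (admissible representations).
-/

set_option autoImplicit false
-- the mandated namespace has the single-problem summit's repeated segment (`HodgeConjecture.HodgeConjecture`)
set_option linter.dupNamespace false

noncomputable section

open Matrix MeasureTheory NumberField NumberField.InfinitePlace Metric Filter Topology
open scoped Matrix ComplexConjugate ComplexOrder InnerProductSpace BoundedContinuousFunction
open Literature.NumberTheory.Automorphic Literature.NumberTheory.Automorphic.UnitaryGroup
open Literature.NumberTheory.Automorphic.UnitaryGroup.CotangentForms (toQuotFun toQuotFun_mk)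
open Literature.NumberTheory.Automorphic.UnitaryCurveForms
open Literature.AlgebraicGeometry.ShimuraVarieties
open Summit.HodgeConjecture.HodgeConjecture.Cruxes.H413.SpectrumJunction
open Summit.HodgeConjecture.HodgeConjecture.Cruxes.HLiu418.E2Density
open Summit.HodgeConjecture.HodgeConjecture.Cruxes.HLiu418.E2SliceModulus
open Summit.HodgeConjecture.HodgeConjecture.Cruxes.HLiu418.E2ArchOrthHolCM

namespace Summit.HodgeConjecture.HodgeConjecture.Cruxes.HLiu418.E2LevelFinite

variable {F E : Type} [Field F] [NumberField F] [Field E] [NumberField E] [Algebra F E]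
  {c : E ≃ₐ[F] E} {J : Matrix (Fin 2) (Fin 2) E}
  {hc : c ≠ 1} {hfix : ∀ w : InfinitePlace E, c • w = w} {w₁ : {w : InfinitePlace E // IsComplex w}} {𝔣 : ConeFrame E J w₁}

/-! ## §1 Level-`K_f` forms near a point: only the `w₁`-component moves the value -/

/-- For `f ∈ holCotForms₂ … 𝔣` right-invariant under `K_f ≤ U(J)(𝔸_{F,f})` and `h ∈ U(J)(𝔸_F)` with finite part in `K_f`:
`f (x h) = f (x · ι(u_h))` with `u_h := (h_∞)_{w₁}` (`h = ι(u_h) · k · (1, h_f)`, `k` in the archimedean factor away from `w₁`).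
[cite: BorelJacquet1979, §4.1 and §4.2] -/
theorem apply_mul_eq_apply_mul_adelicSingle {f : (adelicGroupData F E c 2 J).Adelic → ℂ} (hf : f ∈ holCotForms₂ F E c J hc hfix w₁ 𝔣)
    {Kf : Subgroup (finAdelic F E c 2 J)} (hfK : ∀ k ∈ Kf, ∀ x, f (x * finAdelicToAdelic F E c 2 J k) = f x)
    (h : (adelicGroupData F E c 2 J).Adelic) (hh : finPart F E c 2 J h ∈ Kf) (x : (adelicGroupData F E c 2 J).Adelic) :
    f (x * h) = f (x * adelicSingle F E c 2 J hc hfix w₁ (archAt F E c 2 J w₁ (hfix w₁.1) hc (archPart F E c 2 J h))) := by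
  set u := archAt F E c 2 J w₁ (hfix w₁.1) hc (archPart F E c 2 J h) with hu
  obtain ⟨a', ha', heq⟩ := exists_eq_archSingle_mul F E c 2 J hc hfix w₁ (archPart F E c 2 J h)
  have hdec : x * h = x * adelicSingle F E c 2 J hc hfix w₁ u * archToAdelic F E c 2 J a' * finAdelicToAdelic F E c 2 J (finPart F E c 2 J h) := by
    conv_lhs => rw [← archToAdelic_mul_finAdelicToAdelic F E c 2 J h, heq, ← hu]
    rw [map_mul, adelicSingle_apply, ← mul_assoc, ← mul_assoc]
  have hk : archToAdelic F E c 2 J a' ∈ ((archAt F E c 2 J w₁ (hfix w₁.1) hc).ker).map (archToAdelic F E c 2 J) :=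
    ⟨a', MonoidHom.mem_ker.2 ha', rfl⟩
  rw [hdec, hfK _ hh, apply_mul_of_mem_holCotForms₂ hf hk]

/-! ## §2 Equicontinuity of the unit ball of level-`K_f` cone forms on the compact quotient -/

section Equi

/-- **EQUICONTINUITY.**  For a cone frame with `⟪v₀,t₀⟫ = 0`, `⟪v₀,v₀⟫ = −r⟪t₀,t₀⟫` and an OPEN subgroup `K_f`: the family of functions
`toQuotFun f` on the automorphic quotient, `f ∈ holCotForms₂ … 𝔣` right-`K_f`-invariant with `|f| ≤ 1`, is equicontinuous.
[cite: Borel1997, §8] [cite: BorelJacquet1979, §4.2] -/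
theorem equicontinuous_levelForms (hvt : star 𝔣.v₀ ⬝ᵥ (J.map w₁.1.embedding *ᵥ 𝔣.t₀) = 0) {r : ℝ} (hr : 0 < r)
    (hvv : star 𝔣.v₀ ⬝ᵥ (J.map w₁.1.embedding *ᵥ 𝔣.v₀) = -(r : ℂ) * (star 𝔣.t₀ ⬝ᵥ (J.map w₁.1.embedding *ᵥ 𝔣.t₀)))
    {Kf : Subgroup (finAdelic F E c 2 J)} (hKo : IsOpen (Kf : Set (finAdelic F E c 2 J))) :
    Equicontinuous (fun g : {g : (adelicGroupData F E c 2 J).automorphicQuotient →ᵇ ℂ //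
        ∃ f ∈ holCotForms₂ F E c J hc hfix w₁ 𝔣, (∀ k ∈ Kf, ∀ x, f (x * finAdelicToAdelic F E c 2 J k) = f x) ∧ (∀ y, ‖f y‖ ≤ 1) ∧
          ⇑g = toQuotFun (adelicGroupData F E c 2 J) f} => (⇑(g : (adelicGroupData F E c 2 J).automorphicQuotient →ᵇ ℂ))) := by
  intro ξ₀
  rw [Metric.equicontinuousAt_iff_right]
  intro ε hε
  obtain ⟨g₀, rfl⟩ := toAutomorphicQuotient_surjective ξ₀
  -- the uniform modulus along `U`, transported to a neighbourhood of `1` in `U(J)(𝔸_F)`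
  have hmod := eventually_norm_sub_le (F := F) (c := c) (hc := hc) (hfix := hfix) (𝔣 := 𝔣) hvt hr hvv 1 (half_pos hε)
  have hcontU : Continuous fun h : (adelicGroupData F E c 2 J).Adelic => archAt F E c 2 J w₁ (hfix w₁.1) hc (archPart F E c 2 J h⁻¹) :=
    (continuous_archAt F E c 2 J w₁ (hfix w₁.1) hc).comp ((continuous_archPart F E c 2 J).comp continuous_inv)
  have h1 : ∀ᶠ h in 𝓝 (1 : (adelicGroupData F E c 2 J).Adelic), ∀ f : (adelicGroupData F E c 2 J).Adelic → ℂ,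
      f ∈ holCotForms₂ F E c J hc hfix w₁ 𝔣 → (∀ y, ‖f y‖ ≤ 1) →
      ∀ x, ‖f (x * adelicSingle F E c 2 J hc hfix w₁ (archAt F E c 2 J w₁ (hfix w₁.1) hc (archPart F E c 2 J h⁻¹))) - f x‖ ≤ ε / 2 := by
    have ht : Tendsto (fun h : (adelicGroupData F E c 2 J).Adelic => archAt F E c 2 J w₁ (hfix w₁.1) hc (archPart F E c 2 J h⁻¹)) (𝓝 1) (𝓝 1) := by
      have := hcontU.tendsto 1
      rwa [inv_one, map_one, map_one] at this
    exact ht.eventually hmod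
  have h2 : ∀ᶠ h in 𝓝 (1 : (adelicGroupData F E c 2 J).Adelic), finPart F E c 2 J h⁻¹ ∈ Kf := by
    have ht : Tendsto (fun h : (adelicGroupData F E c 2 J).Adelic => finPart F E c 2 J h⁻¹) (𝓝 1) (𝓝 1) := by
      have := ((continuous_finPart F E c 2 J).comp continuous_inv).tendsto 1
      rwa [Function.comp_apply, inv_one, map_one] at this
    exact ht.eventually (hKo.mem_nhds Kf.one_mem)
  -- the neighbourhood `{[h g₀] : h ∈ N}` of `ξ₀ = [g₀]`
  obtain ⟨Nb, hNb, hNb'⟩ := (h1.and h2).exists_mem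
  have hopen : IsOpenMap fun h : (adelicGroupData F E c 2 J).Adelic => (adelicGroupData F E c 2 J).toAutomorphicQuotient (h * g₀) :=
    QuotientGroup.isOpenMap_coe.comp (isOpenMap_mul_right g₀)
  have hmem : (fun h : (adelicGroupData F E c 2 J).Adelic => (adelicGroupData F E c 2 J).toAutomorphicQuotient (h * g₀)) '' Nb ∈
      𝓝 ((adelicGroupData F E c 2 J).toAutomorphicQuotient g₀) := by
    have := hopen.image_mem_nhds hNb
    rwa [one_mul] at this
  filter_upwards [hmem] with ξ hξ
  obtain ⟨h, hh, rfl⟩ := hξ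
  rintro ⟨g, f, hf, hfK, hf1, hgf⟩
  obtain ⟨hA, hB⟩ := hNb' h hh
  change dist (g ((adelicGroupData F E c 2 J).toAutomorphicQuotient g₀)) (g ((adelicGroupData F E c 2 J).toAutomorphicQuotient (h * g₀))) < ε
  rw [hgf, toQuotFun_mk (leftInvariant_of_mem_holCotForms₂ hf), toQuotFun_mk (leftInvariant_of_mem_holCotForms₂ hf), _root_.mul_inv_rev,
    apply_mul_eq_apply_mul_adelicSingle hf hfK h⁻¹ hB g₀⁻¹, dist_comm, dist_eq_norm]
  exact lt_of_le_of_lt (hA f hf hf1 g₀⁻¹) (half_lt_self hε)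

/-- **Arzelà–Ascoli**: the family of §2 has COMPACT closure in `C(X)` and is totally bounded. [cite: Borel1997, §8] -/
theorem totallyBounded_levelForms [CompactSpace (adelicGroupData F E c 2 J).automorphicQuotient]
    (hvt : star 𝔣.v₀ ⬝ᵥ (J.map w₁.1.embedding *ᵥ 𝔣.t₀) = 0) {r : ℝ} (hr : 0 < r)
    (hvv : star 𝔣.v₀ ⬝ᵥ (J.map w₁.1.embedding *ᵥ 𝔣.v₀) = -(r : ℂ) * (star 𝔣.t₀ ⬝ᵥ (J.map w₁.1.embedding *ᵥ 𝔣.t₀)))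
    {Kf : Subgroup (finAdelic F E c 2 J)} (hKo : IsOpen (Kf : Set (finAdelic F E c 2 J))) :
    TotallyBounded {g : (adelicGroupData F E c 2 J).automorphicQuotient →ᵇ ℂ |
        ∃ f ∈ holCotForms₂ F E c J hc hfix w₁ 𝔣, (∀ k ∈ Kf, ∀ x, f (x * finAdelicToAdelic F E c 2 J k) = f x) ∧ (∀ y, ‖f y‖ ≤ 1) ∧
          ⇑g = toQuotFun (adelicGroupData F E c 2 J) f} := by
  refine (IsCompact.totallyBounded ?_).subset subset_closure
  refine BoundedContinuousFunction.arzela_ascoli (closedBall (0 : ℂ) 1) (isCompact_closedBall 0 1) _ ?_ ?_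
  · rintro g ξ ⟨f, hf, -, hf1, hgf⟩
    obtain ⟨x, rfl⟩ := toAutomorphicQuotient_surjective ξ
    rw [mem_closedBall, dist_zero_right, hgf, toQuotFun_mk (leftInvariant_of_mem_holCotForms₂ hf)]
    exact hf1 _
  · exact equicontinuous_levelForms hvt hr hvv hKo

end Equi

/-! ## §3 Finite-dimensionality of fixed vectors realised in cone-holomorphic forms -/

section Finite

variable [CompactSpace (adelicGroupData F E c 2 J).automorphicQuotient]

/-- **Fixed vectors are finite-dimensional.**  `σ` irreducible on `W`, `ψ : W → (U(J)(𝔸_F) → ℂ)` a NON-ZERO linear map equivariant for right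
translation with cone-holomorphic values; then for every OPEN subgroup `K_f` the `K_f`-fixed vectors `W^{K_f}` are finite-dimensional:
`w ↦ toQuotFun (ψ w)` is an injective linear map into `C(X)` whose unit ball lies in the totally bounded family of §2 (Riesz, Mathlib
`FiniteDimensional.of_totallyBounded_nhds_zero`). [cite: Borel1997, §8] [cite: BernsteinZelevinsky1976, §2.1] -/
theorem finite_fixedPoints_of_equivariant (hvt : star 𝔣.v₀ ⬝ᵥ (J.map w₁.1.embedding *ᵥ 𝔣.t₀) = 0) {r : ℝ} (hr : 0 < r)
    (hvv : star 𝔣.v₀ ⬝ᵥ (J.map w₁.1.embedding *ᵥ 𝔣.v₀) = -(r : ℂ) * (star 𝔣.t₀ ⬝ᵥ (J.map w₁.1.embedding *ᵥ 𝔣.t₀)))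
    {W : Type} [AddCommGroup W] [Module ℂ W] (σ : Representation ℂ (finAdelic F E c 2 J) W) (hirr : σ.IsIrreducible)
    (ψ : W →ₗ[ℂ] ((adelicGroupData F E c 2 J).Adelic → ℂ))
    (hE : ∀ (k : finAdelic F E c 2 J) (w : W), ψ (σ k w) = rightRep₂ F E c J k (ψ w))
    (hV : ∀ w, ψ w ∈ holCotForms₂ F E c J hc hfix w₁ 𝔣) (hne : ψ ≠ 0) (Kf : OpenSubgroup (finAdelic F E c 2 J)) :
    Module.Finite ℂ (σ.fixedPoints (Kf : Subgroup (finAdelic F E c 2 J))) := by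
  haveI := hirr
  -- `ψ` is injective (its kernel is a subrepresentation of the irreducible `σ`, and `ψ ≠ 0`)
  have hψinj : Function.Injective ψ := by
    let N : Subrepresentation σ :=
      { toSubmodule := LinearMap.ker ψ
        apply_mem_toSubmodule := fun g w hw => by
          rw [LinearMap.mem_ker] at hw ⊢
          rw [hE, hw, map_zero] }
    rcases IsSimpleOrder.eq_bot_or_eq_top N with hN | hN
    · rw [← LinearMap.ker_eq_bot]
      exact congrArg Subrepresentation.toSubmodule hN
    · exact absurd (LinearMap.ker_eq_top.1 (congrArg Subrepresentation.toSubmodule hN)) hne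
  -- continuity and left invariance of the values
  have hL : ∀ w, ∀ γ ∈ (adelicGroupData F E c 2 J).quotientSubgroup, ∀ x, ψ w (γ * x) = ψ w x :=
    fun w => leftInvariant_of_mem_holCotForms₂ (hV w)
  have hC : ∀ w, Continuous (toQuotFun (adelicGroupData F E c 2 J) (ψ w)) :=
    fun w => continuous_toQuotFun (hL w) (continuous_of_mem_holCotForms₂ F E c J hc hfix w₁ 𝔣 (hV w))
  -- the linear map `T : W^{K_f} → C(X)`
  let T : σ.fixedPoints (Kf : Subgroup (finAdelic F E c 2 J)) →ₗ[ℂ] ((adelicGroupData F E c 2 J).automorphicQuotient →ᵇ ℂ) :=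
    { toFun := fun w => BoundedContinuousFunction.mkOfCompact ⟨toQuotFun (adelicGroupData F E c 2 J) (ψ w), hC w⟩
      map_add' := fun w w' => by
        ext ξ
        simp only [BoundedContinuousFunction.mkOfCompact_apply, ContinuousMap.coe_mk, BoundedContinuousFunction.coe_add, Pi.add_apply,
          Submodule.coe_add, map_add, toQuotFun]
      map_smul' := fun r' w => by
        ext ξ
        simp only [BoundedContinuousFunction.mkOfCompact_apply, ContinuousMap.coe_mk, BoundedContinuousFunction.coe_smul, Pi.smul_apply,
          Submodule.coe_smul, map_smul, RingHom.id_apply, toQuotFun, smul_eq_mul] }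
  have hTapp : ∀ (w : σ.fixedPoints (Kf : Subgroup (finAdelic F E c 2 J))) ξ, T w ξ = toQuotFun (adelicGroupData F E c 2 J) (ψ w) ξ :=
    fun _ _ => rfl
  have hTinj : Function.Injective T := by
    intro w w' hww
    apply Subtype.ext
    apply hψinj
    funext y
    rw [apply_eq_toQuotFun (hL w) y, apply_eq_toQuotFun (hL w') y, ← hTapp, ← hTapp, hww]
  -- the unit ball of `range T` lies in the totally bounded family of §2
  have htb : TotallyBounded (closedBall (0 : LinearMap.range T) 1) := by
    refine (totallyBounded_preimage isometry_subtype_coe.isUniformInducing (totallyBounded_levelForms (hc := hc) (hfix := hfix) hvt hr hvv Kf.isOpen)).subset ?_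
    rintro ⟨g, ⟨w, rfl⟩⟩ hg
    rw [mem_closedBall, dist_zero_right] at hg
    refine ⟨ψ w, hV w, fun k hk x => ?_, fun y => ?_, funext fun ξ => hTapp w ξ⟩
    · -- right `K_f`-invariance from `σ k w = w`
      have hfix' : σ k (w : W) = w := by
        have hw := w.2
        rw [Representation.mem_fixedPoints] at hw
        exact hw k hk
      have h := hE k (w : W)
      rw [hfix'] at h
      have h2 : ψ (w : W) x = ψ (w : W) (x * finAdelicToAdelic F E c 2 J k) := (congrFun h x).trans (rightRep₂_apply F E c J k _ x)
      exact h2.symm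
    · -- `|ψ w| ≤ ‖T w‖ ≤ 1`
      rw [apply_eq_toQuotFun (hL w) y, ← hTapp]
      exact (BoundedContinuousFunction.norm_coe_le_norm (T w) _).trans hg
  haveI : FiniteDimensional ℂ (LinearMap.range T) :=
    FiniteDimensional.of_totallyBounded_nhds_zero ℂ (closedBall_mem_nhds (0 : LinearMap.range T) one_pos) htb
  exact Module.Finite.equiv (LinearEquiv.ofInjective T hTinj).symm

end Finite

/-! ## §4 S3₂ CLOSED: `AdmissibleOfHolValuedType₂` in the letter's binder prefix -/

/-- **S3₂ CLOSED — `admissibleOfHolValued₂_holds`**: the body of the K-E₂ cut `AdmissibleOfHolValuedType₂` TOKEN FOR TOKEN — an irreducible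
smooth `σ` of `U(H)(𝔸_{L⁺,f})` with a non-zero equivariant linear map into the cone-holomorphic cotangent forms (contained in a discrete `P`;
unused) is ADMISSIBLE. [cite: BernsteinZelevinsky1976, §2.1] [cite: Borel1997, §8] [cite: BorelWallach2000, VII 3.2] -/
theorem admissibleOfHolValued₂_holds :
    ∀ (L : Type) [Field L] [NumberField L] [IsCMField L] (ι : L →+* ℂ) (H : Matrix (Fin 2) (Fin 2) L)
    (dV : Fin 2 → L) (_hdV : ∀ i, IsCMField.complexConj L (dV i) = dV i) (_hdV0 : ∀ i, dV i ≠ 0)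
    (t : L) (_ht : t ≠ 0) (g : GL (Fin 2) L),
    formCongr ((IsCMField.complexConj L : L ≃ₐ[↥(maximalRealSubfield L)] L) : L →+* L) g (t • H) = Matrix.diagonal dV →
    (∃ T : GL (Fin 2) ℂ, formCongr (starRingEnd ℂ) T ((Matrix.diagonal dV).map ι) = Matrix.diagonal ![(1 : ℂ), -1]) →
    (∀ τ' : L →+* ℂ, InfinitePlace.mk τ' ≠ InfinitePlace.mk ι → ((Matrix.diagonal dV).map τ').PosDef) →
    4 ≤ Module.finrank ℚ L →
    ∀ (𝔣 : ConeFrame L H (cmPlace L ι))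
      (μ : Measure (adelicGroupData (↥(maximalRealSubfield L)) L (IsCMField.complexConj L) 2 H).automorphicQuotient)
      [(adelicGroupData (↥(maximalRealSubfield L)) L (IsCMField.complexConj L) 2 H).IsAutomorphicMeasure μ]
      (P : DiscreteAutomorphicRep (adelicGroupData (↥(maximalRealSubfield L)) L (IsCMField.complexConj L) 2 H) μ)
      (W : Type) [AddCommGroup W] [Module ℂ W]
      (σ : Representation ℂ (finAdelic (↥(maximalRealSubfield L)) L (IsCMField.complexConj L) 2 H) W),
      σ.IsIrreducible → σ.IsSmooth →
    ∀ ψ : W →ₗ[ℂ] ((adelicGroupData (↥(maximalRealSubfield L)) L (IsCMField.complexConj L) 2 H).Adelic → ℂ),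
      (∀ (k : finAdelic (↥(maximalRealSubfield L)) L (IsCMField.complexConj L) 2 H) (w : W),
          ψ (σ k w) = rightRep₂ (↥(maximalRealSubfield L)) L (IsCMField.complexConj L) H k (ψ w)) →
      (∀ w : W, ψ w ∈ holCotForms₂ (↥(maximalRealSubfield L)) L (IsCMField.complexConj L) H (IsCMField.complexConj_ne_one L)
          (UnitaryGroup.complexConj_smul_infinitePlace L) (cmPlace L ι) 𝔣 ∧ P.ContainsFun (ψ w)) →
      ψ ≠ 0 → σ.IsAdmissible := by
  intro L _ _ _ ι H dV hdV _ t ht g hg _ hdef h4 𝔣 μ _ P W _ _ σ hirr hsm ψ hE hV hne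
  obtain ⟨τ, hτ⟩ := UnitaryGroup.exists_infinitePlace_ne L h4 ι
  have hanis := S1BettiSliceExclusion.anisotropic_of_formCongr_posDef L H t g dV hg τ (hdef τ hτ)
  haveI := UnitaryGroup.compactSpace_adelicGroupData_automorphicQuotient L 2 H hanis
  obtain ⟨hvt, r, hr, hvv⟩ := frame_hypotheses ι H dV hdV t ht g hg 𝔣
  exact ⟨hsm, fun Kf _ => finite_fixedPoints_of_equivariant hvt hr hvv σ hirr ψ hE (fun w => (hV w).1) hne Kf⟩

/-! ## §5 THE DISCHARGE: the named facts E₂-hol and E₂-antihol are kernel theorems -/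

/-- **E₂-hol — `UnitaryCurveForms.cohIsotypicLine₂_hol` HOLDS** ([Liu2021, App. D §D.1, Lem. D.2 (2)]: the holomorphic cotangent isotypic line
of a discrete `P` of a unitary group in two variables): S1 ★ `stubS1_holds` · S2β₂ ★ `density₂_holds` · S2⁺₂ ★ `archOrthHol₂_holds` · S3₂
`admissibleOfHolValued₂_holds`, composed by ★ `cohIsotypicLine₂_hol_of_admissible`. [cite: Liu2021, App. D Lem. D.2 (2)]
[cite: BorelWallach2000, VI 4.11; VII 3.2] -/
theorem cohIsotypicLine₂_hol_holds : UnitaryCurveForms.cohIsotypicLine₂_hol :=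
  cohIsotypicLine₂_hol_of_admissible admissibleOfHolValued₂_holds

/-- **E₂-antihol — `UnitaryCurveForms.cohIsotypicLine₂_antihol` HOLDS** (by A-p06's conjugation transport ★
`UnitaryCurveForms.cohIsotypicLine₂_antihol_of_hol`). [cite: Liu2021, App. D Lem. D.2 (2)] [cite: BorelWallach2000, VII 2.10 and 3.2] -/
theorem cohIsotypicLine₂_antihol_holds : UnitaryCurveForms.cohIsotypicLine₂_antihol :=
  UnitaryCurveForms.cohIsotypicLine₂_antihol_of_hol cohIsotypicLine₂_hol_holds

end Summit.HodgeConjecture.HodgeConjecture.Cruxes.HLiu418.E2LevelFinite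

end
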